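import Mathlib
import Summits.CriticalPhenomena.PercolationContinuityZ3.Theorems.PercNearOneGluingNoHeavyLowerTailTNKernels
import Summits.CriticalPhenomena.PercolationContinuityZ3.Theorems.PercNearOneGluingNoHeavyLowerTailMomentRatioTN
import Summits.CriticalPhenomena.PercolationContinuityZ3.Theorems.PercNearOneGluingNoHeavyLowerTailBandTwoTN
import HarnessLib

/-!
# Quadratic-row kernels, II: a completely monotone annihilator peels the band (THEOREM 3 of the three-ray memo)

Support file for the Sahi / Conjecture-P programme of route `PercNearOneGluingNoHeavy`
(`--supports stmt-CriticalPhenomena-4575`, prover prim-l12-p5 gen 43; proof note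
`prim-l12-p5/PROOF-THREE-RAYS-g43.md` §2 (LEMMA 2) and §4 (THEOREM 3)).  No definitions, no named facts, no sorries.

Companion of `…LowerTailBandTwoTN` (the chain-sequence criterion, "Type III").  Here ("Type II" of the memo: one
integer copy below and one above B's ray, so that `C_n ≤ 0`):

**THEOREM (`bandTwo_choose_tn_of_cm`).**  Let `A_n > 0`, `C_n ≤ 0`, `B_0 = C_0 = C_1 = 0`, and let `μ` be a
STRICTLY COMPLETELY MONOTONE solution of `A_n μ_n + B_n μ_{n-1} + C_n μ_{n-2} = 0` (`n ≥ 2`) with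
`A_1 μ_1 + B_1 μ_0 ≥ 0`.  Then `K(n,l) = A_n C(n,l) + B_n C(n-1,l) + C_n C(n-2,l)` is totally nonnegative:
`K = 𝔅 · Q_μ` with `𝔅` nonnegative lower bidiagonal (`BandTwoTN.bidiag_minor_nonneg`) and `Q_μ` the W♯ kernel of
`…LowerTailMomentRatioTN` (`momentRatio_tn`).
-/

namespace Summit.CriticalPhenomena.PercolationContinuityZ3.Theorems

namespace BandTwoCM

open Finset Matrix BandTwoTN
open scoped Nat

/-! ### A completely monotone annihilator (memo §4, THEOREM 3: the Type II reduction)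

If instead of the chain condition one knows a STRICTLY COMPLETELY MONOTONE solution `μ` of the
three-term recurrence `A_n μ_n + B_n μ_{n-1} + C_n μ_{n-2} = 0` (`n ≥ 2`) with `C_n ≤ 0` and
`A_1 μ_1 + B_1 μ_0 ≥ 0`, then the same kernel peels as `𝔅 · Q_μ` with `𝔅` nonnegative lower bidiagonal
(`A_n` on the diagonal, `-C_n μ_{n-2}/μ_{n-1} ≥ 0` below it) and `Q_μ` the W♯ kernel of
`…LowerTailMomentRatioTN` (rows `(1+x)^{t-1}(x + 1 - μ_t/μ_{t-1})`), which is TN by `momentRatio_tn`. -/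

/-- g35's kernel `Q_μ` in `choose` form: `Q_μ(t,l) = C(t,l) - ρ_t C(t-1,l)` with `ρ_0 = 0`, `ρ_t = μ_t/μ_{t-1}`. -/
theorem momentRatio_entry_eq (μ : ℕ → ℝ) (t l : ℕ) :
    ((if t = 0 then (if l = 0 then (1:ℝ) else 0)
      else (if l = 0 then (0:ℝ) else ((t - 1).choose (l - 1) : ℝ)) + (1 - μ t / μ (t - 1)) * ((t - 1).choose l : ℝ)))
    = (t.choose l : ℝ) - (if t = 0 then 0 else μ t / μ (t - 1)) * ((t - 1).choose l : ℝ) := by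
  rcases Nat.eq_zero_or_pos t with ht | ht
  · subst ht
    rcases Nat.eq_zero_or_pos l with hl | hl
    · subst hl; simp
    · rw [if_pos rfl, if_neg (by omega), if_pos rfl, Nat.choose_eq_zero_of_lt hl]; simp
  · obtain ⟨t', rfl⟩ : ∃ t', t = t' + 1 := ⟨t - 1, by omega⟩
    have h1 : t' + 1 ≠ 0 := Nat.succ_ne_zero t'
    rcases Nat.eq_zero_or_pos l with hl | hl
    · subst hl
      rw [if_neg h1, if_neg h1, if_pos rfl]
      simp
    · obtain ⟨l', rfl⟩ : ∃ l', l = l' + 1 := ⟨l - 1, by omega⟩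
      rw [if_neg h1, if_neg h1, if_neg (Nat.succ_ne_zero l')]
      simp only [Nat.add_sub_cancel, Nat.choose_succ_succ, Nat.cast_add]
      ring

/-- **THEOREM 3 of the memo (Type II reduction), abstract form.**  Let `A_n > 0`, `C_n ≤ 0` (`B_0 = C_0 = C_1 = 0`),
and let `μ` be strictly completely monotone with `A_n μ_n + B_n μ_{n-1} + C_n μ_{n-2} = 0` for `n ≥ 2` and
`A_1 μ_1 + B_1 μ_0 ≥ 0`.  Then the kernel `A_n C(n,l) + B_n C(n-1,l) + C_n C(n-2,l)` is totally nonnegative. -/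
theorem bandTwo_choose_tn_of_cm (A B C μ : ℕ → ℝ) (hA : ∀ n, 0 < A n) (hB0 : B 0 = 0)
    (hC : ∀ n, C n ≤ 0) (hC0 : C 0 = 0) (hC1 : C 1 = 0)
    (hμ : ∀ k j, 0 < ∑ i ∈ range (k + 1), (-1 : ℝ) ^ i * (k.choose i : ℝ) * μ (j + i))
    (hrec : ∀ n, 2 ≤ n → A n * μ n + B n * μ (n - 1) + C n * μ (n - 2) = 0)
    (hrow1 : 0 ≤ A 1 * μ 1 + B 1 * μ 0)
    {k : ℕ} (r c : Fin k → ℕ) (hr : StrictMono r) (hc : StrictMono c) :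
    0 ≤ (Matrix.of fun i j => A (r i) * ((r i).choose (c j) : ℝ) + B (r i) * (((r i) - 1).choose (c j) : ℝ)
      + C (r i) * (((r i) - 2).choose (c j) : ℝ)).det := by
  have hpos : ∀ n, 0 < μ n := MomentRatioTN.pos_of_altSum μ hμ
  let ρ : ℕ → ℝ := fun t => if t = 0 then 0 else μ t / μ (t - 1)
  have hρ0 : ρ 0 = 0 := rfl
  have hρpos : ∀ t, 1 ≤ t → 0 < ρ t := fun t ht => by
    show 0 < (if t = 0 then 0 else μ t / μ (t - 1))
    rw [if_neg (by omega)]; exact div_pos (hpos _) (hpos _)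
  have hρ : ∀ t, 1 ≤ t → ρ t = μ t / μ (t - 1) := fun t ht => if_neg (by omega)
  -- subdiagonal of the left factor
  let q : ℕ → ℝ := fun n => if n = 1 then A 1 * μ 1 / μ 0 + B 1 else -C n / ρ (n - 1)
  have hq0 : q 0 = 0 := by
    show (if (0:ℕ) = 1 then A 1 * μ 1 / μ 0 + B 1 else -C 0 / ρ (0 - 1)) = 0
    rw [if_neg (by omega), hC0, neg_zero, zero_div]
  have hq1 : q 1 = A 1 * μ 1 / μ 0 + B 1 := if_pos rfl
  have hq2 : ∀ n, 2 ≤ n → q n = -C n / ρ (n - 1) := fun n hn => if_neg (by omega)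
  have hqnn : ∀ n, 0 ≤ q n := by
    intro n
    rcases Nat.lt_or_ge n 2 with h | h
    · interval_cases n
      · rw [hq0]
      · rw [hq1]
        have h0 := hpos 0
        have : A 1 * μ 1 / μ 0 + B 1 = (A 1 * μ 1 + B 1 * μ 0) / μ 0 := by field_simp
        rw [this]; exact div_nonneg hrow1 h0.le
    · rw [hq2 n h]
      exact div_nonneg (neg_nonneg.2 (hC n)) (hρpos (n - 1) (by omega)).le
  -- the row identity
  have hrow : ∀ n l : ℕ, A n * (n.choose l : ℝ) + B n * ((n - 1).choose l : ℝ) + C n * ((n - 2).choose l : ℝ) =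
      ∑ t ∈ range (n + 1), (if t = n then A n else if t + 1 = n then q n else 0) *
        ((t.choose l : ℝ) - ρ t * ((t - 1).choose l : ℝ)) := by
    intro n l
    rw [sum_bidiag A q (fun t => (t.choose l : ℝ) - ρ t * ((t - 1).choose l : ℝ)) hq0 n]
    rcases Nat.lt_or_ge n 2 with h | h
    · interval_cases n
      · simp [hρ0, hB0, hC0, hq0]
      · have hμ0 : μ 0 ≠ 0 := (hpos 0).ne'
        simp only [hq1, hC1, hρ0, Nat.sub_self, zero_mul, add_zero, sub_zero, hρ 1 le_rfl]
        field_simp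
        ring
    · obtain ⟨m, rfl⟩ : ∃ m, n = m + 2 := ⟨n - 2, by omega⟩
      have e1 : (m + 2 - 1 : ℕ) = m + 1 := by omega
      have e2 : (m + 1 - 1 : ℕ) = m := by omega
      have e3 : (m + 2 - 2 : ℕ) = m := by omega
      have hr2 := hrec (m + 2) (by omega)
      rw [e1, e3] at hr2
      have hρa : ρ (m + 2) = μ (m + 2) / μ (m + 1) := by rw [hρ (m + 2) (by omega), e1]
      have hρb : ρ (m + 1) = μ (m + 1) / μ m := by rw [hρ (m + 1) (by omega), e2]
      have hqm : q (m + 2) = -C (m + 2) / ρ (m + 1) := by rw [hq2 (m + 2) (by omega), e1]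
      have hμm : μ m ≠ 0 := (hpos m).ne'
      have hμm1 : μ (m + 1) ≠ 0 := (hpos (m + 1)).ne'
      -- B = -A ρ_{m+2} + q,  C = -q ρ_{m+1}
      have hBid : B (m + 2) = -A (m + 2) * ρ (m + 2) + q (m + 2) := by
        rw [hqm, hρa, hρb, div_div_eq_mul_div]
        apply mul_right_cancel₀ hμm1
        have h1 : (-A (m + 2) * (μ (m + 2) / μ (m + 1)) + -C (m + 2) * μ m / μ (m + 1)) * μ (m + 1)
            = -(A (m + 2) * μ (m + 2)) - C (m + 2) * μ m := by
          rw [add_mul, mul_assoc, div_mul_cancel₀ _ hμm1, div_mul_cancel₀ _ hμm1]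
          ring
        rw [h1]
        linarith [hr2]
      have hCid : C (m + 2) = -(q (m + 2) * ρ (m + 1)) := by
        rw [hqm, div_mul_cancel₀ _ (hρpos (m + 1) (by omega)).ne']
        ring
      rw [e1, e2, e3]
      rw [hCid, hBid]
      ring
  have heq : (Matrix.of fun i j => A (r i) * ((r i).choose (c j) : ℝ) + B (r i) * (((r i) - 1).choose (c j) : ℝ)
      + C (r i) * (((r i) - 2).choose (c j) : ℝ)) =
      Matrix.of fun i j => ∑ t ∈ range (r i + 1), (if t = r i then A (r i) else if t + 1 = r i then q (r i) else 0) *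
        ((t.choose (c j) : ℝ) - ρ t * ((t - 1).choose (c j) : ℝ)) := by
    ext i j
    rw [Matrix.of_apply, Matrix.of_apply, hrow]
  rw [heq]
  set N := (univ.sup r) + (univ.sup c) + 1 with hN
  refine TNKernel.mulLower_minor_nonneg
    (fun n t => if t = n then A n else if t + 1 = n then q n else 0)
    (fun t l => (t.choose l : ℝ) - ρ t * ((t - 1).choose l : ℝ)) N ?_ ?_ ?_ r c hr hc (fun i => ?_) (fun j => ?_)
  · intro k' r' c' hr' hc'
    exact bidiag_minor_nonneg A q hA hqnn r' c' hr' hc'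
  · intro k' r' c' hr' hc' _ _
    have hQ : (Matrix.of fun i j => ((r' i).choose (c' j) : ℝ) - ρ (r' i) * (((r' i) - 1).choose (c' j) : ℝ)) =
        Matrix.of fun i j => (if r' i = 0 then (if c' j = 0 then (1:ℝ) else 0)
          else (if c' j = 0 then (0:ℝ) else ((r' i - 1).choose (c' j - 1) : ℝ))
            + (1 - μ (r' i) / μ (r' i - 1)) * ((r' i - 1).choose (c' j) : ℝ)) := by
      ext i j
      rw [Matrix.of_apply, Matrix.of_apply, momentRatio_entry_eq]
    rw [hQ]
    exact MomentRatioTN.momentRatio_tn μ hμ r' c' hr' hc'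
  · intro n t hnt
    rw [if_neg (by omega), if_neg (by omega)]
  · have : r i ≤ univ.sup r := Finset.le_sup (f := r) (mem_univ i)
    omega
  · have : c j ≤ univ.sup c := Finset.le_sup (f := c) (mem_univ j)
    omega

end BandTwoCM

end Summit.CriticalPhenomena.PercolationContinuityZ3.Theorems
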